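/-
Copyright (c) 2026. All rights reserved.
Released under Apache 2.0 license as described in the file LICENSE.
-/
import Literature.AlgebraicGeometry.Pohlmann1968.MultiquadraticCMFieldRankFiveTypesHodgeConjecture
import HarnessLib

/-!
# The stabiliser of a CM type bounds its rank; the extremal types are those induced from nondegenerate types, and
# their abelian varieties satisfy the Hodge conjecture with all their powers

SETTING.  `K` a CM field (any — not assumed Galois or abelian), `Φ` a CM type of `K`, `Rank(Φ) = cmTypeRank Φ`
(Kubota–Dodson, tree `Pohlmann1968.cmTypeRank`; `Rank ≤ [K:ℚ]/2 + 1`, equality = NONDEGENERATE, tree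
`IsNondegenerate`), and `Stab(Φ) = {σ ∈ Aut(K) : Φσ = Φ}` its stabiliser (tree `twistStabilizer`, Bouw et al.
[BCLLMNO2015] Prop. 3.3 after S. Lang, *Complex Multiplication* Ch. I Thm. 3.6).  By Lang's criterion (tree
`exists_eq_inducedCMType_fixedField_twistStabilizer`) `Φ = Ψ^K` is INDUCED from a CM type `Ψ` of the fixed field
`k_Φ = K^{Stab(Φ)}`, `[K : k_Φ] = |Stab(Φ)|`, and induced types keep the rank (G. Shimura [Shimura1998] §32.9, tree
`cmTypeRank_inducedCMType`).  Hence: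

> **Theorem** (`two_mul_natCard_twistStabilizer_mul_cmTypeRank_sub_one_le`, every CM field).
> `2·|Stab(Φ)|·(Rank(Φ) − 1) ≤ [K:ℚ]`, i.e. `Rank(Φ) ≤ [k_Φ : ℚ]/2 + 1`
> (`cmTypeRank_le_finrank_fixedField_twistStabilizer`); a NONDEGENERATE type has TRIVIAL stabiliser
> (`twistStabilizer_eq_bot_of_isNondegenerate`).
> **Theorem** (`two_mul_natCard_twistStabilizer_mul_eq_iff`).  EQUALITY holds iff the type `Ψ` of `k_Φ` inducing `Φ`
> is NONDEGENERATE; for `K/ℚ` Galois, iff `Φ` is induced from a nondegenerate type of SOME CM subfield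
> (`two_mul_natCard_twistStabilizer_mul_eq_iff_exists_of_isGalois`).
> **Theorem** (`hodgeConjectureFor_pow_of_two_mul_natCard_twistStabilizer_mul_eq`).  In the equality case every
> abelian variety `A` of type `(K; Φ)` has `Bᵐ(Aⁿ) ⊗ ℂ = Dᵐ(Aⁿ) ⊗ ℂ` for all `n, m` and satisfies the HODGE CONJECTURE
> WITH ALL ITS POWERS (Pohlmann–Hazama transfer along `Φ = Ψ^K`, tree
> `IsNondegenerate.hodgeClassSpan_pow_eq_divisorClassesSpan_inducedCMType`).

This is the field-side reading of the tree's group-level `AbelianStabilizer.two_mul_card_stabilizer_mul_typeRank_sub_one_le`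
/ `two_mul_card_stabilizer_mul_eq_iff` (abelian `K`, character counting) and, for abelian `K`, Shimura's reflex bound
`rank ≤ [K* : ℚ]/2 + 1` ([Shimura1998] §32.10, tree `IsCMTypeWith.typeRank_le_card_orbit`); it UNIFIES the tree's
"HC for all powers" families for CM types: nondegenerate types (`Stab = 1`), rank `2` (induced from an imaginary
quadratic subfield, tree `CMTypeRankTwo`), the multiplicity-two and rank-`5` types of multiquadratic fields (tree
`MultiquadraticCMFieldWeightTwoTypesHodgeConjecture`, `MultiquadraticCMFieldRankFiveTypesHodgeConjecture`) — each is
the equality case `2·|Stab(Φ)|·(Rank(Φ) − 1) = [K:ℚ]`.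

* §1 `finrank_eq_natCard_twistStabilizer_mul_finrank_fixedField` (`[K:ℚ] = |Stab(Φ)|·[k_Φ:ℚ]`),
  **`cmTypeRank_le_finrank_fixedField_twistStabilizer`**, **`two_mul_natCard_twistStabilizer_mul_cmTypeRank_sub_one_le`**,
  `cmTypeRank_le_finrank_div_add_one`, **`twistStabilizer_eq_bot_of_isNondegenerate`**,
  `natCard_twistStabilizer_le_of_cmTypeRank` (`|Stab(Φ)|·2(Rank − 1) ≤ [K:ℚ]` as a bound on the stabiliser).
* §2 `isNondegenerate_of_inducedCMType_fixedField_of_eq` / `eq_of_inducedCMType_isNondegenerate_fixedField`,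
  **`two_mul_natCard_twistStabilizer_mul_eq_iff`**, `two_mul_natCard_twistStabilizer_mul_eq_of_isNondegenerate`, and for
  `K/ℚ` Galois `finrank_le_natCard_twistStabilizer_of_inducedCMType`,
  **`two_mul_natCard_twistStabilizer_mul_eq_iff_exists_of_isGalois`**, `two_mul_natCard_twistStabilizer_mul_eq_of_inducedCMType`.
* §3 **`hodgeClassSpan_pow_eq_divisorClassesSpan_of_two_mul_natCard_twistStabilizer_mul_eq`**,
  **`hodgeConjectureFor_pow_of_two_mul_natCard_twistStabilizer_mul_eq`**,
  `hodgeConjectureFor_pow_of_inducedCMType_isNondegenerate` (any CM subfield, any CM field).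

HONEST SCOPE.  Assembly of tree theorems (Lang's induced-type criterion, Shimura's rank invariance, Pohlmann–Hazama
for induced nondegenerate types); the sources print those, the stabiliser-cardinality form and the word "extremal"
are this file's packaging.  The converse "`Bᵐ(Aⁿ) = Dᵐ(Aⁿ)` for all `n, m` ⟹ equality" (Hazama's criterion, tree
`cmTypeRank_eq_iff_forall_pow_hodgeClassSpan_eq_inducedCMType`) needs the primitivity of `Ψ` on `k_Φ` and is not
restated here.  THEOREMS ONLY: no definition, no named fact, no instance, no `sorry`.

## References

* [Shimura1998] G. Shimura, *Abelian Varieties with Complex Multiplication and Modular Functions*, §8.2 Prop. 26,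
  §8.4 Example (1), §32.9–32.10.
* [BCLLMNO2015] I. Bouw, J. Cooley, K. Lauter, E. Lorenzo García, M. Manes, R. Newton, E. Ozman, *Bad reduction of
  genus three curves with complex multiplication*, §3 Prop. 3.3.
* [Lang1983ComplexMultiplication] S. Lang, *Complex Multiplication*, Ch. I Thm. 3.6.
* [Kubota1965] T. Kubota, *On the field extension by complex multiplication*, Trans. AMS 118 (1965), §2.
* [Gordon1999HodgeAVSurvey] B. B. Gordon, *A survey of the Hodge conjecture for abelian varieties*, Thm. 6.4, §9.3–9.4.

## Provenance

Lane `lit-hodgefound` (Track 2, Layers A4/A5), seat `lit-hodgefound-p10` generation 39, row g39-#7; neighbours cited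
by name, nothing restated: `NumberTheory/ComplexMultiplication/CMTypeEquivalenceClassesCount` (`twistStabilizer`,
`exists_eq_inducedCMType_fixedField_twistStabilizer`, `fixingSubgroup_le_twistStabilizer_inducedCMType`),
`CMTypeInducedFromPrimitive` (`isCMField_of_cmType_intermediateField`), `Pohlmann1968/CMTypeRankInducedType`
(`cmTypeRank_inducedCMType`, `cmTypeRank_inducedCMType_le`), `NondegenerateCMTypeDivisorClasses`
(`isNondegenerate_iff`, `cmTypeRank_le`), `NonSimpleCMAbelianVarietyHazamaCriterion`
(`IsNondegenerate.hodgeClassSpan_pow_eq_divisorClassesSpan_inducedCMType`), `MultiquadraticCMFieldRankFiveTypesHodgeConjecture`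
(`Multiquadratic.hodgeConjectureFor_of_forall_hodgeClassSpan_eq_divisorClassesSpan`), `CMTypeLattice`
(`two_mul_card_eq_finrank`); group-level twin `DegenerateCMTypesAbelianStabilizerIndexBound` (g39-#6).
-/

open scoped BigOperators NumberField Classical
open NumberField Module CategoryTheory CategoryTheory.Limits IntermediateField

namespace Literature.AlgebraicGeometry.Pohlmann1968

open scoped Literature.NumberTheory.ComplexMultiplication
open Literature.NumberTheory.ComplexMultiplication (inducedCMType twistStabilizer mem_twistStabilizer_iff
  isCMField_of_cmType_intermediateField exists_eq_inducedCMType_fixedField_twistStabilizer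
  exists_eq_inducedCMType_fixedField_of_le_twistStabilizer fixingSubgroup_le_twistStabilizer_inducedCMType)
open Literature.AlgebraicGeometry.Motives (CMType AbelianVariety)
open Literature.AlgebraicGeometry.HodgeTheory
open Literature.AlgebraicGeometry.VanGeemen1994 (hodgeClassSpan)
open Literature.Barriers.HodgeConjecture (divisorClassesSpan)
open Literature.AlgebraicGeometry.ComplexMultiplication (IsCMTypeRealisation)

variable {K : Type} [Field K] [NumberField K] [IsCMField K]
  {A : AbelianVariety ℂ} {ι : 𝓞 K →+* End A} {θ : K →+* Module.End ℂ (complexBetti A.X 1)}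

/-! ## §0 Helpers -/

section Helpers

omit [IsCMField K] in
/-- The degree of a number field carrying a CM type is even and positive: `[K:ℚ] = 2·#Φ`, `#Φ ≥ 1`. [folklore] -/
private theorem finrank_eq_two_mul_of_cmType (Φ : CMType K) :
    ∃ g : ℕ, 0 < g ∧ finrank ℚ K = 2 * g := by
  refine ⟨Fintype.card Φ.1, ?_, (Literature.NumberTheory.ComplexMultiplication.CMTypeLattice.two_mul_card_eq_finrank Φ).symm⟩
  have hpos : 0 < finrank ℚ K := finrank_pos
  have h := Literature.NumberTheory.ComplexMultiplication.CMTypeLattice.two_mul_card_eq_finrank Φ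
  omega

end Helpers

/-! ## §1 The bound `2·|Stab(Φ)|·(Rank(Φ) − 1) ≤ [K:ℚ]` -/

section Bound

omit [IsCMField K] in
/-- `[K:ℚ] = |Stab(Φ)|·[K^{Stab(Φ)} : ℚ]` (Artin: `[K : K^H] = |H|`, and the tower law).
[cite: BCLLMNO2015, §3 Prop. 3.3] -/
theorem finrank_eq_natCard_twistStabilizer_mul_finrank_fixedField (Φ : CMType K) :
    finrank ℚ K = Nat.card (twistStabilizer Φ) * finrank ℚ (fixedField (twistStabilizer Φ)) := by
  rw [← IntermediateField.finrank_fixedField_eq_card (twistStabilizer Φ), mul_comm]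
  exact (Module.finrank_mul_finrank ℚ (fixedField (twistStabilizer Φ)) K).symm

/-- **`Rank(Φ) ≤ [K^{Stab(Φ)} : ℚ]/2 + 1`** for every CM type of every CM field: `Φ = Ψ^K` is induced from its
stabiliser's fixed field `k_Φ` (Lang), `Rank(Ψ^K) = Rank(Ψ)` (Shimura §32.9) and `Rank(Ψ) ≤ [k_Φ:ℚ]/2 + 1`
(Kubota–Dodson). [cite: Shimura1998, §32.9–32.10] [cite: BCLLMNO2015, §3 Prop. 3.3] [cite: Lang1983ComplexMultiplication, Ch. I Thm. 3.6] -/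
theorem cmTypeRank_le_finrank_fixedField_twistStabilizer (Φ : CMType K) :
    cmTypeRank Φ ≤ finrank ℚ (fixedField (twistStabilizer Φ)) / 2 + 1 := by
  obtain ⟨Ψ, hΨ⟩ := exists_eq_inducedCMType_fixedField_twistStabilizer Φ
  haveI : IsCMField (fixedField (twistStabilizer Φ)) :=
    isCMField_of_cmType_intermediateField (fixedField (twistStabilizer Φ)) Ψ
  have h := cmTypeRank_inducedCMType_le (algebraMap (fixedField (twistStabilizer Φ)) K) Ψ
  rw [hΨ] at h
  exact h

/-- **THE STABILISER BOUNDS THE RANK: `2·|Stab(Φ)|·(Rank(Φ) − 1) ≤ [K:ℚ]`** — every CM type of every CM field.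
[cite: Shimura1998, §32.9–32.10] [cite: BCLLMNO2015, §3 Prop. 3.3] -/
theorem two_mul_natCard_twistStabilizer_mul_cmTypeRank_sub_one_le (Φ : CMType K) :
    2 * Nat.card (twistStabilizer Φ) * (cmTypeRank Φ - 1) ≤ finrank ℚ K := by
  have h1 := cmTypeRank_le_finrank_fixedField_twistStabilizer Φ
  have h2 := finrank_eq_natCard_twistStabilizer_mul_finrank_fixedField Φ
  have h3 : cmTypeRank Φ - 1 ≤ finrank ℚ (fixedField (twistStabilizer Φ)) / 2 := by omega
  calc 2 * Nat.card (twistStabilizer Φ) * (cmTypeRank Φ - 1)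
      ≤ 2 * Nat.card (twistStabilizer Φ) * (finrank ℚ (fixedField (twistStabilizer Φ)) / 2) :=
        Nat.mul_le_mul_left _ h3
    _ = Nat.card (twistStabilizer Φ) * (2 * (finrank ℚ (fixedField (twistStabilizer Φ)) / 2)) := by ring
    _ ≤ Nat.card (twistStabilizer Φ) * finrank ℚ (fixedField (twistStabilizer Φ)) :=
        Nat.mul_le_mul_left _ (Nat.mul_div_le _ 2)
    _ = finrank ℚ K := h2.symm

/-- **`Rank(Φ) ≤ [K:ℚ]/(2|Stab(Φ)|) + 1`.** [cite: Shimura1998, §32.9–32.10] [cite: BCLLMNO2015, §3 Prop. 3.3] -/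
theorem cmTypeRank_le_finrank_div_add_one (Φ : CMType K) :
    cmTypeRank Φ ≤ finrank ℚ K / (2 * Nat.card (twistStabilizer Φ)) + 1 := by
  have h1 := two_mul_natCard_twistStabilizer_mul_cmTypeRank_sub_one_le Φ
  have hpos : 0 < 2 * Nat.card (twistStabilizer Φ) := by
    have : 0 < Nat.card (twistStabilizer Φ) := Nat.card_pos
    omega
  have h2 : cmTypeRank Φ - 1 ≤ finrank ℚ K / (2 * Nat.card (twistStabilizer Φ)) :=
    (Nat.le_div_iff_mul_le hpos).2 (by rwa [mul_comm] at h1)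
  omega

/-- **The stabiliser of a type of rank `r` has order `≤ [K:ℚ]/(2(r − 1))`** (`r ≥ 2`). [cite: BCLLMNO2015, §3 Prop. 3.3]
[cite: Shimura1998, §32.9–32.10] -/
theorem natCard_twistStabilizer_le_of_cmTypeRank (Φ : CMType K) (hr : 2 ≤ cmTypeRank Φ) :
    Nat.card (twistStabilizer Φ) ≤ finrank ℚ K / (2 * (cmTypeRank Φ - 1)) := by
  have h1 := two_mul_natCard_twistStabilizer_mul_cmTypeRank_sub_one_le Φ
  have hpos : 0 < 2 * (cmTypeRank Φ - 1) := by omega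
  refine (Nat.le_div_iff_mul_le hpos).2 ?_
  calc Nat.card (twistStabilizer Φ) * (2 * (cmTypeRank Φ - 1))
      = 2 * Nat.card (twistStabilizer Φ) * (cmTypeRank Φ - 1) := by ring
    _ ≤ finrank ℚ K := h1

/-- **A NONDEGENERATE CM TYPE HAS TRIVIAL STABILISER** (`Rank = [K:ℚ]/2 + 1` and `2|Stab|(Rank − 1) ≤ [K:ℚ]` force
`|Stab| = 1`) — every CM field; hence a nondegenerate type is primitive (Kubota §2 "a nondegenerate CM-type is
primitive", via BCLLMNO Prop. 3.3 / Shimura §8.2 Prop. 26 for Galois `K`). [cite: Kubota1965, §2]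
[cite: BCLLMNO2015, §3 Prop. 3.3] -/
theorem twistStabilizer_eq_bot_of_isNondegenerate {Φ : CMType K} (hΦ : IsNondegenerate Φ) :
    twistStabilizer Φ = ⊥ := by
  have h1 := two_mul_natCard_twistStabilizer_mul_cmTypeRank_sub_one_le Φ
  rw [(isNondegenerate_iff Φ).1 hΦ, Nat.add_sub_cancel] at h1
  obtain ⟨g, hg, hK⟩ := finrank_eq_two_mul_of_cmType Φ
  rw [hK, Nat.mul_div_cancel_left _ two_pos] at h1
  have hpos : 0 < Nat.card (twistStabilizer Φ) := Nat.card_pos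
  have hle : Nat.card (twistStabilizer Φ) ≤ 1 := by
    by_contra hlt
    have : 2 * 2 * g ≤ 2 * Nat.card (twistStabilizer Φ) * g :=
      Nat.mul_le_mul_right _ (Nat.mul_le_mul_left _ (by omega))
    omega
  exact Subgroup.eq_bot_of_card_le (twistStabilizer Φ) hle

end Bound

/-! ## §2 The equality case: types induced from nondegenerate types -/

section Extremal

/-- If `Φ = Ψ^K` for a type `Ψ` of the stabiliser's fixed field `k_Φ`, then **equality
`2|Stab(Φ)|(Rank(Φ) − 1) = [K:ℚ]` forces `Ψ` to be NONDEGENERATE** (`Rank(Ψ) = Rank(Φ) = [k_Φ:ℚ]/2 + 1`).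
[cite: Shimura1998, §32.9] [cite: BCLLMNO2015, §3 Prop. 3.3] -/
theorem isNondegenerate_of_inducedCMType_fixedField_of_eq {Φ : CMType K}
    {Ψ : CMType (fixedField (twistStabilizer Φ))} (hΨ : inducedCMType (algebraMap _ K) Ψ = Φ)
    (heq : 2 * Nat.card (twistStabilizer Φ) * (cmTypeRank Φ - 1) = finrank ℚ K) : IsNondegenerate Ψ := by
  have h2 := finrank_eq_natCard_twistStabilizer_mul_finrank_fixedField Φ
  have hpos : 0 < Nat.card (twistStabilizer Φ) := Nat.card_pos
  have hr : cmTypeRank Φ = cmTypeRank Ψ := by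
    rw [← cmTypeRank_inducedCMType (algebraMap (fixedField (twistStabilizer Φ)) K) Ψ, hΨ]
  have hk : 0 < finrank ℚ (fixedField (twistStabilizer Φ)) := finrank_pos
  rw [isNondegenerate_iff, ← hr]
  have h3 : 2 * (cmTypeRank Φ - 1) = finrank ℚ (fixedField (twistStabilizer Φ)) := by
    apply Nat.eq_of_mul_eq_mul_left hpos
    calc Nat.card (twistStabilizer Φ) * (2 * (cmTypeRank Φ - 1))
        = 2 * Nat.card (twistStabilizer Φ) * (cmTypeRank Φ - 1) := by ring
      _ = finrank ℚ K := heq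
      _ = Nat.card (twistStabilizer Φ) * finrank ℚ (fixedField (twistStabilizer Φ)) := h2
  have h1 := cmTypeRank_le_finrank_fixedField_twistStabilizer Φ
  omega

omit [IsCMField K] in
/-- Conversely, **if the type `Ψ` of `k_Φ` inducing `Φ` is nondegenerate then `2|Stab(Φ)|(Rank(Φ) − 1) = [K:ℚ]`.**
[cite: Shimura1998, §32.9] [cite: BCLLMNO2015, §3 Prop. 3.3] -/
theorem eq_of_inducedCMType_isNondegenerate_fixedField {Φ : CMType K}
    {Ψ : CMType (fixedField (twistStabilizer Φ))} (hΨ : inducedCMType (algebraMap _ K) Ψ = Φ)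
    (hnd : IsNondegenerate Ψ) : 2 * Nat.card (twistStabilizer Φ) * (cmTypeRank Φ - 1) = finrank ℚ K := by
  have h2 := finrank_eq_natCard_twistStabilizer_mul_finrank_fixedField Φ
  have hr : cmTypeRank Φ = cmTypeRank Ψ := by
    rw [← cmTypeRank_inducedCMType (algebraMap (fixedField (twistStabilizer Φ)) K) Ψ, hΨ]
  obtain ⟨g, -, hk⟩ := finrank_eq_two_mul_of_cmType Ψ
  rw [isNondegenerate_iff, hk, Nat.mul_div_cancel_left _ two_pos] at hnd
  rw [hr, hnd, Nat.add_sub_cancel, h2, hk]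
  ring

/-- **THE EQUALITY CASE `2·|Stab(Φ)|·(Rank(Φ) − 1) = [K:ℚ]` ⟺ `Φ` IS INDUCED FROM A NONDEGENERATE TYPE OF
`k_Φ = K^{Stab(Φ)}`** (every CM field `K`).  Instances: nondegenerate `Φ` (`Stab = 1`); for `K/ℚ` Galois, rank-`2`
types (`Φ = Ψ^K`, `Ψ` on an imaginary quadratic subfield) and the multiplicity-two / rank-`5` types of
multiquadratic fields. [cite: Shimura1998, §32.9–32.10] [cite: BCLLMNO2015, §3 Prop. 3.3] [cite: Kubota1965, §2] -/
theorem two_mul_natCard_twistStabilizer_mul_eq_iff (Φ : CMType K) :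
    2 * Nat.card (twistStabilizer Φ) * (cmTypeRank Φ - 1) = finrank ℚ K ↔
      ∃ Ψ : CMType (fixedField (twistStabilizer Φ)), inducedCMType (algebraMap _ K) Ψ = Φ ∧ IsNondegenerate Ψ := by
  constructor
  · intro heq
    obtain ⟨Ψ, hΨ⟩ := exists_eq_inducedCMType_fixedField_twistStabilizer Φ
    exact ⟨Ψ, hΨ, isNondegenerate_of_inducedCMType_fixedField_of_eq hΨ heq⟩
  · rintro ⟨Ψ, hΨ, hnd⟩
    exact eq_of_inducedCMType_isNondegenerate_fixedField hΨ hnd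

omit [IsCMField K] in
/-- For `K/ℚ` Galois and `Φ = Ψ^K` induced from ANY CM subfield `k`: `Gal(K/k) ≤ Stab(Φ)`, so `[K:k] ≤ |Stab(Φ)|`.
[cite: BCLLMNO2015, §3 Prop. 3.3] [cite: Lang1983ComplexMultiplication, Ch. I Thm. 3.6] -/
theorem finrank_le_natCard_twistStabilizer_of_inducedCMType [IsGalois ℚ K] (k : IntermediateField ℚ K)
    (Ψ : CMType k) {Φ : CMType K} (hΨ : inducedCMType (algebraMap k K) Ψ = Φ) :
    finrank k K ≤ Nat.card (twistStabilizer Φ) := by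
  have hle := fixingSubgroup_le_twistStabilizer_inducedCMType k Ψ
  rw [hΨ] at hle
  rw [← IsGalois.card_fixingSubgroup_eq_finrank k]
  exact Subgroup.card_le_of_le hle

/-- **`K/ℚ` GALOIS: a type induced from a NONDEGENERATE type of ANY CM subfield `k` is extremal**,
`2·|Stab(Φ)|·(Rank(Φ) − 1) = [K:ℚ]` (and then `|Stab(Φ)| = [K:k]`, `k = k_Φ`). [cite: Shimura1998, §32.9–32.10]
[cite: BCLLMNO2015, §3 Prop. 3.3] -/
theorem two_mul_natCard_twistStabilizer_mul_eq_of_inducedCMType [IsGalois ℚ K] (k : IntermediateField ℚ K)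
    (Ψ : CMType k) {Φ : CMType K} (hΨ : inducedCMType (algebraMap k K) Ψ = Φ) (hnd : IsNondegenerate Ψ) :
    2 * Nat.card (twistStabilizer Φ) * (cmTypeRank Φ - 1) = finrank ℚ K := by
  refine le_antisymm (two_mul_natCard_twistStabilizer_mul_cmTypeRank_sub_one_le Φ) ?_
  have hr : cmTypeRank Φ = cmTypeRank Ψ := by rw [← cmTypeRank_inducedCMType (algebraMap k K) Ψ, hΨ]
  obtain ⟨g, -, hk⟩ := finrank_eq_two_mul_of_cmType Ψ
  have hnd' := hnd
  rw [isNondegenerate_iff, hk, Nat.mul_div_cancel_left _ two_pos] at hnd'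
  have hS := finrank_le_natCard_twistStabilizer_of_inducedCMType k Ψ hΨ
  have htower : finrank ℚ K = finrank ℚ k * finrank k K := (Module.finrank_mul_finrank ℚ k K).symm
  rw [hr, hnd', Nat.add_sub_cancel, htower, hk]
  calc 2 * g * finrank (↥k) K ≤ 2 * g * Nat.card (twistStabilizer Φ) := Nat.mul_le_mul_left _ hS
    _ = 2 * Nat.card (twistStabilizer Φ) * g := by ring

/-- **`K/ℚ` GALOIS: `2·|Stab(Φ)|·(Rank(Φ) − 1) = [K:ℚ]` ⟺ `Φ` is induced from a NONDEGENERATE type of SOME CM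
subfield.** [cite: Shimura1998, §32.9–32.10] [cite: BCLLMNO2015, §3 Prop. 3.3] [cite: Kubota1965, §2] -/
theorem two_mul_natCard_twistStabilizer_mul_eq_iff_exists_of_isGalois [IsGalois ℚ K] (Φ : CMType K) :
    2 * Nat.card (twistStabilizer Φ) * (cmTypeRank Φ - 1) = finrank ℚ K ↔
      ∃ (k : IntermediateField ℚ K) (Ψ : CMType k), inducedCMType (algebraMap k K) Ψ = Φ ∧ IsNondegenerate Ψ := by
  constructor
  · intro heq
    obtain ⟨Ψ, hΨ, hnd⟩ := (two_mul_natCard_twistStabilizer_mul_eq_iff Φ).1 heq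
    exact ⟨_, Ψ, hΨ, hnd⟩
  · rintro ⟨k, Ψ, hΨ, hnd⟩
    exact two_mul_natCard_twistStabilizer_mul_eq_of_inducedCMType k Ψ hΨ hnd

/-- A nondegenerate type is extremal (`Stab = 1`, `Rank − 1 = [K:ℚ]/2`). [cite: Kubota1965, §2] -/
theorem two_mul_natCard_twistStabilizer_mul_eq_of_isNondegenerate {Φ : CMType K} (hΦ : IsNondegenerate Φ) :
    2 * Nat.card (twistStabilizer Φ) * (cmTypeRank Φ - 1) = finrank ℚ K := by
  rw [twistStabilizer_eq_bot_of_isNondegenerate hΦ, Subgroup.card_bot, (isNondegenerate_iff Φ).1 hΦ,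
    Nat.add_sub_cancel]
  obtain ⟨g, -, hK⟩ := finrank_eq_two_mul_of_cmType Φ
  omega

end Extremal

/-! ## §3 The Hodge conjecture for all powers in the extremal case -/

section Hodge

/-- **`Bᵐ(Aⁿ) ⊗ ℂ = Dᵐ(Aⁿ) ⊗ ℂ` FOR ALL `n, m` IN THE EXTREMAL CASE**: if `2|Stab(Φ)|(Rank(Φ) − 1) = [K:ℚ]` then
every abelian variety of type `(K; Φ)` has all its Hodge classes on all powers generated by divisor classes
(`Φ = Ψ^K` with `Ψ` nondegenerate; Pohlmann–Hazama transfer). [cite: Gordon1999HodgeAVSurvey, Thm. 6.4 and §9.3]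
[cite: Shimura1998, §32.9] -/
theorem hodgeClassSpan_pow_eq_divisorClassesSpan_of_two_mul_natCard_twistStabilizer_mul_eq (Φ : CMType K)
    (heq : 2 * Nat.card (twistStabilizer Φ) * (cmTypeRank Φ - 1) = finrank ℚ K)
    (hA : IsCMTypeRealisation Φ A ι θ) (n m : ℕ) :
    hodgeClassSpan (⨁ fun _ : Fin n => A).dim (⨁ fun _ : Fin n => A).X m =
      divisorClassesSpan (⨁ fun _ : Fin n => A).X (⨁ fun _ : Fin n => A).dim m := by
  obtain ⟨Ψ, hΨ, hnd⟩ := (two_mul_natCard_twistStabilizer_mul_eq_iff Φ).1 heq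
  haveI : IsCMField (fixedField (twistStabilizer Φ)) :=
    isCMField_of_cmType_intermediateField (fixedField (twistStabilizer Φ)) Ψ
  exact hnd.hodgeClassSpan_pow_eq_divisorClassesSpan_inducedCMType hΨ hA n m

/-- **THE HODGE CONJECTURE FOR EVERY POWER OF EVERY ABELIAN VARIETY OF AN EXTREMAL CM TYPE** (every CM field `K`,
every `Φ` with `2|Stab(Φ)|(Rank(Φ) − 1) = [K:ℚ]`, every realisation, every `n`).
[cite: Gordon1999HodgeAVSurvey, Thm. 6.4 and §9.3] [cite: Shimura1998, §32.9] -/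
theorem hodgeConjectureFor_pow_of_two_mul_natCard_twistStabilizer_mul_eq (Φ : CMType K)
    (heq : 2 * Nat.card (twistStabilizer Φ) * (cmTypeRank Φ - 1) = finrank ℚ K)
    (hA : IsCMTypeRealisation Φ A ι θ) (n : ℕ) :
    HodgeConjectureFor (⨁ fun _ : Fin n => A).dim (⨁ fun _ : Fin n => A).X :=
  Multiquadratic.hodgeConjectureFor_of_forall_hodgeClassSpan_eq_divisorClassesSpan _
    (fun m => hodgeClassSpan_pow_eq_divisorClassesSpan_of_two_mul_natCard_twistStabilizer_mul_eq Φ heq hA n m)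

/-- **The Hodge conjecture for every power of every abelian variety whose CM type is induced from a NONDEGENERATE
type of a CM subfield** (`Φ = Ψ^K`, `Ψ` nondegenerate on `k ⊆ K`; every CM field `K`, every realisation, every `n`)
— the Pohlmann–Hazama transfer `Bᵐ(Aⁿ) = Dᵐ(Aⁿ)` (tree `IsNondegenerate.hodgeClassSpan_pow_eq_divisorClassesSpan_inducedCMType`)
read as the Hodge conjecture. [cite: Gordon1999HodgeAVSurvey, Thm. 6.4 and §9.3] [cite: Shimura1998, §32.9] -/
theorem hodgeConjectureFor_pow_of_inducedCMType_isNondegenerate (k : IntermediateField ℚ K) (Ψ : CMType k)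
    {Φ : CMType K} (hΨ : inducedCMType (algebraMap k K) Ψ = Φ) (hnd : IsNondegenerate Ψ)
    (hA : IsCMTypeRealisation Φ A ι θ) (n : ℕ) :
    HodgeConjectureFor (⨁ fun _ : Fin n => A).dim (⨁ fun _ : Fin n => A).X := by
  haveI : IsCMField k := isCMField_of_cmType_intermediateField k Ψ
  exact Multiquadratic.hodgeConjectureFor_of_forall_hodgeClassSpan_eq_divisorClassesSpan _
    (fun m => hnd.hodgeClassSpan_pow_eq_divisorClassesSpan_inducedCMType hΨ hA n m)

end Hodge

end Literature.AlgebraicGeometry.Pohlmann1968
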